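import Mathlib
import HarnessLib
import Summits.ResolutionOfSingularities.ResolutionOfSingularities.Theorems.WildQuotientsWildQuotientResolutionS1aSymCover
import Summits.ResolutionOfSingularities.ResolutionOfSingularities.Theorems.WildQuotientsWildQuotientResolutionS1aRootModel
import Summits.ResolutionOfSingularities.ResolutionOfSingularities.Theorems.WildQuotientsWildQuotientResolutionS1aA1Move2Node

/-!
# S1a — THE SYMMETRIC ROOT MOVE, chart level: the FREE MODEL `k[x_none, x′][1/H]` of the node of ANY producer chart of the symmetric root, with all pins

[OURS · L1 W4.5c · lead-1 g15; R3 brick 3 (after ✓`…S1aSymRoot`, ✓`…S1aSymCover`, ✓`…S1aRootModel`); plan-1 RULING R-F15l; pattern ✓`…S1aA1Move2Model` /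
✓`…S1aA1ModelPins`, for an ABSTRACT pinned root model `Ψ` (✓`FreeModel.exists_rootModelEquiv_X`, `exists_symRootModel`) and an ARBITRARY σ-fixed cover element `y`]
— NOT statements of the manuscript; counted 0; AI-level work, weaker than expert review. Crux stmt-ResolutionOfSingularities-17941 `CyclicQuotientFourfolds`, line
`s1a-logminvertex` v13 (`stub_reachLowerInFX`). Datum of ✓`…S1aSymRoot` (`σx₃ = x₃ + x₁·r`, `e⁻¹r ∈ 𝒥_{δ−1}`; centre `e⁻¹(x₀, x₁, x₂)`, weights `(δ+1, 1, 1)`).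
* generic (`CobordantTransport`, any model `Ψ : R^w ≃ P`): `modelSigma_apply_algebraMap` (`conj Φ σ_chart ∘ Ψ = Ψ ∘ σ_R` in `P[1/Ψc]`, `Φ = chartRingEquivAway … Ψ`),
  `modelSigma_invSelf`, `chartRingEquivAway_algebraMap_mul_invSelf`, `modelSigma_algebraMap_coverElement`;
* `sym_sigmaP_*` (`σ_P = conj Ψ σ_R` on the generators), `sym_model_tail_pin` (`x_none^{δ−1}·Ψ(e⁻¹r t^{δ−1}) = subst r`); on `Φ : ChartRing_y ≃ k[x_none, x′][1/Ψ(yT^{dbar})]`: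
  ROWS `sym_model_row_*` (`x_none, X₀′, H⁻¹`, constants fixed; `X_j′ ↦ X_j′ + x_none^δ X₀′`; `x₃ ↦ x₃ + x_none^δ X₁′ R` for `subst r = x_none^{δ−1} R`), DEGREES
  `sym_model_degree_*` relative to `θ = consIndexEquiv mo (1,0)` (`X₀′ : (δ+1)θ`, `X₁′, X₂′ : θ`, `x₃ : 0`, `R : (δ−1)θ`, `x_none : −θ`, `H⁻¹ : −dbar θ`), PINS `sym_model_residual_*`.
-/

set_option linter.dupNamespace false

noncomputable section

open Literature.AlgebraicGeometry.Resolution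
open scoped LaurentPolynomial
open MvPolynomial
open Summit.ResolutionOfSingularities.ResolutionOfSingularities.Theorems.WildQuotientResolution.S1
open Summit.ResolutionOfSingularities.ResolutionOfSingularities.Theorems.WildQuotientResolution.S1.CoarseChart
open Summit.ResolutionOfSingularities.ResolutionOfSingularities.Theorems.WildQuotientResolution.S1.ProducerStep
open Summit.ResolutionOfSingularities.ResolutionOfSingularities.Theorems.WildQuotientResolution.S1.ReesBigrading
open Summit.ResolutionOfSingularities.ResolutionOfSingularities.Theorems.WildQuotientResolution.S1.NodeTransport
open Summit.ResolutionOfSingularities.ResolutionOfSingularities.Theorems.WildQuotientResolution.S1.CobordantTransport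
open Summit.ResolutionOfSingularities.ResolutionOfSingularities.Theorems.WildQuotientResolution.S1.BlowupCharts
open Summit.ResolutionOfSingularities.ResolutionOfSingularities.Theorems.WildQuotientResolution.S1.FreeModel

/-! ## Generic: the model automorphism of a producer chart read through any model `Ψ : R^w ≃ P` -/

namespace Summit.ResolutionOfSingularities.ResolutionOfSingularities.Theorems.WildQuotientResolution.S1.CobordantTransport

universe u

section Generic
variable {m : ℕ} (r : Fin m → ℕ) {B : Type u} [CommRing B] (𝒜 : (Π j : Fin m, ZMod (r j)) → AddSubgroup B) [GradedRing 𝒜] {c : ℕ}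
  (f : Fin c → B) (w : Fin c → ℕ) (d : ℕ) (b : ↥(𝒜 0)) (hb : b ∈ (traceFiltration 𝒜 f w).ideal d)
  (σ : B ≃+* B) (hσJ : ∀ n : ℕ, ((weightedFiltration f w).ideal n).map (σ : B →+* B) ≤ (weightedFiltration f w).ideal n)
  {p : ℕ} (hp : 0 < p) (hσp : ∀ x : B, (⇑σ)^[p] x = x) (hσb : σ (b : B) = b)
  {P : Type u} [CommRing P] (Ψ : ↥(cobordantAlgebra f w) ≃+* P)

/-- ★ **`σ′` on the model**: `conj Φ σ_chart (algebraMap (Ψ z)) = algebraMap (Ψ (σ_R z))` for `z ∈ R^w`, `Φ = chartRingEquivAway … Ψ`. [OURS · L1 W4.5c] -/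
theorem modelSigma_apply_algebraMap (z : ↥(cobordantAlgebra f w)) :
    conj (chartRingEquivAway 𝒜 f w d b hb Ψ) (sigmaChart 𝒜 f w d b hb σ hσJ hp hσp hσb) (algebraMap P (Localization.Away (Ψ (coverElement 𝒜 f w d b hb))) (Ψ z)) =
      algebraMap P (Localization.Away (Ψ (coverElement 𝒜 f w d b hb))) (Ψ (sigmaR σ f w hσJ hp hσp z)) := by
  rw [← chartRingEquivAway_algebraMap, conj_apply_map, sigmaChart_algebraMap, chartRingEquivAway_algebraMap]

/-- `σ′` fixes the inverted cover element of the model. [OURS · L1 W4.5c] -/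
theorem modelSigma_invSelf :
    conj (chartRingEquivAway 𝒜 f w d b hb Ψ) (sigmaChart 𝒜 f w d b hb σ hσJ hp hσp hσb) (IsLocalization.Away.invSelf (Ψ (coverElement 𝒜 f w d b hb))) =
      IsLocalization.Away.invSelf (Ψ (coverElement 𝒜 f w d b hb)) := by
  rw [← chartRingEquivAway_invSelf, conj_apply_map, sigmaChart_invSelf]

/-- Pin: the model value of a residual section `v · c⁻¹` is `Ψ v · (Ψ c)⁻¹`. -/
theorem chartRingEquivAway_algebraMap_mul_invSelf (v : ↥(cobordantAlgebra f w)) :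
    chartRingEquivAway 𝒜 f w d b hb Ψ (algebraMap _ (ChartRing 𝒜 f w d b hb) v * IsLocalization.Away.invSelf (coverElement 𝒜 f w d b hb)) =
      algebraMap P (Localization.Away (Ψ (coverElement 𝒜 f w d b hb))) (Ψ v) * IsLocalization.Away.invSelf (Ψ (coverElement 𝒜 f w d b hb)) := by
  rw [map_mul, chartRingEquivAway_algebraMap, chartRingEquivAway_invSelf]

/-- `σ′` fixes the model value `algebraMap (Ψ c)` of the cover element. -/
theorem modelSigma_algebraMap_coverElement :
    conj (chartRingEquivAway 𝒜 f w d b hb Ψ) (sigmaChart 𝒜 f w d b hb σ hσJ hp hσp hσb)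
        (algebraMap P (Localization.Away (Ψ (coverElement 𝒜 f w d b hb))) (Ψ (coverElement 𝒜 f w d b hb))) =
      algebraMap P (Localization.Away (Ψ (coverElement 𝒜 f w d b hb))) (Ψ (coverElement 𝒜 f w d b hb)) := by
  rw [modelSigma_apply_algebraMap, sigmaR_coverElement 𝒜 f w d b hb σ hσJ hp hσp hσb]

end Generic

end Summit.ResolutionOfSingularities.ResolutionOfSingularities.Theorems.WildQuotientResolution.S1.CobordantTransport

/-! ## The symmetric root: a pinned root model and `σ_P` on its generators -/

namespace Summit.ResolutionOfSingularities.ResolutionOfSingularities.Theorems.WildQuotientResolution.S1.KillCert.Sym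

variable {k : Type} [Field k] {A : Type} [CommRing A]
  (σ : MvPolynomial (Fin 4) k ≃+* MvPolynomial (Fin 4) k) (hC : ∀ a : k, σ (C a) = C a)
  (h0 : σ (X 0) = X 0) (h1 : σ (X 1) = X 1 + X 0) (h2 : σ (X 2) = X 2 + X 0) (δ : ℕ) (r : MvPolynomial (Fin 4) k)
  (h3 : σ (X 3) = X 3 + X 1 * r)
  (e : A ≃+* MvPolynomial (Fin 4) k) (τ : A ≃+* A) (hact : ∀ t : A, τ t = e.symm (σ (e t)))
  (hr : e.symm r ∈ (weightedFiltration (e.symm ∘ ![X 0, X 1, X 2] : Fin 3 → A) ![δ + 1, 1, 1]).ideal (δ - 1)) (hδ : 1 ≤ δ)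
  {p : ℕ} (hp : 0 < p) (hσp : ∀ x : A, (⇑τ)^[p] x = x)
  (hσJ : ∀ n : ℕ, ((weightedFiltration (e.symm ∘ ![X 0, X 1, X 2] : Fin 3 → A) ![δ + 1, 1, 1]).ideal n).map (τ : A →+* A) ≤
    (weightedFiltration (e.symm ∘ ![X 0, X 1, X 2] : Fin 3 → A) ![δ + 1, 1, 1]).ideal n)
  (Ψ : ↥(cobordantAlgebra (e.symm ∘ ![X 0, X 1, X 2] : Fin 3 → A) ![δ + 1, 1, 1]) ≃+* MvPolynomial (Option (Fin 4)) k)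
  (hΨa : ∀ a : MvPolynomial (Fin 4) k, Ψ (algebraMap A _ (e.symm a)) = cobordantAlgebra.subst k (![δ + 1, 1, 1, 0] : Fin 4 → ℕ) a)
  (hΨs : Ψ (cobordantAlgebra.s _ _) = X none)
  (hΨ0 : Ψ (cobordantAlgebra.u' (e.symm ∘ ![X 0, X 1, X 2] : Fin 3 → A) ![δ + 1, 1, 1] 0) = X (some 0))
  (hΨ1 : Ψ (cobordantAlgebra.u' (e.symm ∘ ![X 0, X 1, X 2] : Fin 3 → A) ![δ + 1, 1, 1] 1) = X (some 1))
  (hΨ2 : Ψ (cobordantAlgebra.u' (e.symm ∘ ![X 0, X 1, X 2] : Fin 3 → A) ![δ + 1, 1, 1] 2) = X (some 2))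

/-- ★ **A pinned root model for the symmetric centre exists** (✓`FreeModel.exists_rootModelEquiv_X` for `v = (0, 1, 2)`, `W = (δ+1, 1, 1, 0)`). -/
theorem exists_symRootModel :
    ∃ Ψ : ↥(cobordantAlgebra (e.symm ∘ ![X 0, X 1, X 2] : Fin 3 → A) ![δ + 1, 1, 1]) ≃+* MvPolynomial (Option (Fin 4)) k,
      (∀ a : MvPolynomial (Fin 4) k, Ψ (algebraMap A _ (e.symm a)) = cobordantAlgebra.subst k (![δ + 1, 1, 1, 0] : Fin 4 → ℕ) a) ∧
      Ψ (cobordantAlgebra.s _ _) = X none ∧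
      Ψ (cobordantAlgebra.u' (e.symm ∘ ![X 0, X 1, X 2] : Fin 3 → A) ![δ + 1, 1, 1] 0) = X (some 0) ∧
      Ψ (cobordantAlgebra.u' (e.symm ∘ ![X 0, X 1, X 2] : Fin 3 → A) ![δ + 1, 1, 1] 1) = X (some 1) ∧
      Ψ (cobordantAlgebra.u' (e.symm ∘ ![X 0, X 1, X 2] : Fin 3 → A) ![δ + 1, 1, 1] 2) = X (some 2) := by
  have hfam : (e.symm ∘ ![X 0, X 1, X 2] : Fin 3 → A) = ⇑e.symm ∘ ((X : Fin 4 → MvPolynomial (Fin 4) k) ∘ ![0, 1, 2]) := by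
    funext i; fin_cases i <;> rfl
  have hvW : ∀ i, (![δ + 1, 1, 1, 0] : Fin 4 → ℕ) ((![0, 1, 2] : Fin 3 → Fin 4) i) = (![δ + 1, 1, 1] : Fin 3 → ℕ) i := fun i => by
    fin_cases i <;> rfl
  have hW : ∀ l, (![δ + 1, 1, 1, 0] : Fin 4 → ℕ) l = 0 ∨ ∃ i, (![0, 1, 2] : Fin 3 → Fin 4) i = l := fun l => by
    fin_cases l
    · exact Or.inr ⟨0, rfl⟩
    · exact Or.inr ⟨1, rfl⟩
    · exact Or.inr ⟨2, rfl⟩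
    · exact Or.inl rfl
  obtain ⟨Ψ, ha, -, hs, hu⟩ := exists_rootModelEquiv_X e (![δ + 1, 1, 1, 0] : Fin 4 → ℕ) (![0, 1, 2] : Fin 3 → Fin 4) ![δ + 1, 1, 1] hvW hW
  rw [hfam]
  exact ⟨Ψ, ha, hs, hu 0, hu 1, hu 2⟩

include hΨa in
/-- Pin on the variables: `Ψ(e⁻¹x_l) = x_none^{W l} · x′_l`. -/
theorem sym_model_X (l : Fin 4) : Ψ (algebraMap A _ (e.symm (X l))) = X none ^ (![δ + 1, 1, 1, 0] : Fin 4 → ℕ) l * X (some l) := by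
  rw [hΨa, cobordantAlgebra.subst, MvPolynomial.eval₂Hom_X']

include hΨa in
/-- Pin: `Ψ(e⁻¹x₃) = x′₃` (weight 0). -/
theorem sym_model_X_three : Ψ (algebraMap A _ (e.symm (X 3))) = X (some 3) := by
  rw [sym_model_X δ e Ψ hΨa]; simp

include hΨa hΨs in
/-- ★ **The tail pin**: `x_none^{δ−1} · Ψ(e⁻¹r · t^{δ−1}) = subst r`. -/
theorem sym_model_tail_pin : X none ^ (δ - 1) * Ψ ⟨_, C_mul_T_mem_cobordantAlgebra _ _ hr⟩ = cobordantAlgebra.subst k (![δ + 1, 1, 1, 0] : Fin 4 → ℕ) r := by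
  have hRw : cobordantAlgebra.s (e.symm ∘ ![X 0, X 1, X 2] : Fin 3 → A) ![δ + 1, 1, 1] ^ (δ - 1) * ⟨_, C_mul_T_mem_cobordantAlgebra _ _ hr⟩ =
      algebraMap A _ (e.symm r) := by
    refine Subtype.ext ?_
    rw [MulMemClass.coe_mul, cobordantAlgebra.coe_s_pow, cobordantAlgebra.coe_algebraMap]
    change LaurentPolynomial.T (-((δ - 1 : ℕ) : ℤ)) * (LaurentPolynomial.C (e.symm r) * LaurentPolynomial.T ((δ - 1 : ℕ) : ℤ)) = _
    rw [mul_left_comm, ← LaurentPolynomial.T_add, neg_add_cancel, LaurentPolynomial.T_zero, mul_one]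
  rw [← hΨa, ← hRw, map_mul, map_pow, hΨs]

/-! ### `σ_P = conj Ψ σ_R` on the generators -/
include hΨs in
/-- `σ_P (x_none) = x_none`. -/
theorem sym_sigmaP_X_none : conj Ψ (sigmaR τ _ _ hσJ hp hσp) (X none) = X none := by
  rw [← hΨs, conj_apply_map, sigmaR_s]

include hact h0 hΨ0 in
/-- `σ_P X₀′ = X₀′`. -/
theorem sym_sigmaP_X_some_zero : conj Ψ (sigmaR τ _ _ hσJ hp hσp) (X (some 0)) = X (some 0) := by
  rw [← hΨ0, conj_apply_map]
  congr 1
  have hu0 : cobordantAlgebra.u' (e.symm ∘ ![X 0, X 1, X 2] : Fin 3 → A) ![δ + 1, 1, 1] 0 =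
      ⟨LaurentPolynomial.C (e.symm (X 0)) * LaurentPolynomial.T ((δ + 1 : ℕ) : ℤ), (cobordantAlgebra.u' (e.symm ∘ ![X 0, X 1, X 2] : Fin 3 → A) ![δ + 1, 1, 1] 0).2⟩ := rfl
  rw [hu0, sigmaR_mk]
  exact Subtype.ext (by change LaurentPolynomial.C (τ (e.symm (X 0))) * _ = LaurentPolynomial.C (e.symm (X 0)) * _; rw [A1.act_symm σ e τ hact, h0])

include hact h1 hΨ0 hΨ1 hΨs in
/-- `σ_P X₁′ = X₁′ + x_none^δ · X₀′`. -/
theorem sym_sigmaP_X_some_one : conj Ψ (sigmaR τ _ _ hσJ hp hσp) (X (some 1)) = X (some 1) + X none ^ δ * X (some 0) := by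
  have hu := congrArg (conj Ψ (sigmaR τ _ _ hσJ hp hσp)) hΨ1
  rw [← hu, conj_apply_map]
  have h := sym_sigmaR_u'_one_sub σ h1 δ e τ hact hp hσp hσJ
  rw [sub_eq_iff_eq_add] at h
  rw [h, map_add, map_mul, map_pow, hΨ1, hΨ0, hΨs, add_comm]

include hact h2 hΨ0 hΨ2 hΨs in
/-- `σ_P X₂′ = X₂′ + x_none^δ · X₀′`. -/
theorem sym_sigmaP_X_some_two : conj Ψ (sigmaR τ _ _ hσJ hp hσp) (X (some 2)) = X (some 2) + X none ^ δ * X (some 0) := by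
  have hu := congrArg (conj Ψ (sigmaR τ _ _ hσJ hp hσp)) hΨ2
  rw [← hu, conj_apply_map]
  have h := sym_sigmaR_u'_two_sub σ h2 δ e τ hact hp hσp hσJ
  rw [sub_eq_iff_eq_add] at h
  rw [h, map_add, map_mul, map_pow, hΨ2, hΨ0, hΨs, add_comm]

include hact h3 hr hδ hΨa hΨ1 hΨs in
/-- `σ_P x₃ = x₃ + x_none^δ · X₁′ · R`, `R = Ψ(e⁻¹r·t^{δ−1})`. -/
theorem sym_sigmaP_X_some_three : conj Ψ (sigmaR τ _ _ hσJ hp hσp) (X (some 3)) =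
    X (some 3) + X none ^ δ * (X (some 1) * Ψ ⟨_, C_mul_T_mem_cobordantAlgebra _ _ hr⟩) := by
  have hx := congrArg (conj Ψ (sigmaR τ _ _ hσJ hp hσp)) (sym_model_X_three δ e Ψ hΨa)
  rw [← hx, conj_apply_map]
  have h := sym_sigmaR_algebraMap_three_sub σ δ r h3 e τ hact hr hδ hp hσp hσJ
  rw [sub_eq_iff_eq_add] at h
  rw [h, map_add, map_mul, map_mul, map_pow, sym_model_X_three δ e Ψ hΨa, hΨ1, hΨs, add_comm]

include hact hC hΨa in
/-- `σ_P` fixes constants. -/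
theorem sym_sigmaP_C (a : k) : conj Ψ (sigmaR τ _ _ hσJ hp hσp) (C a) = C a := by
  have hc : Ψ (algebraMap A _ (e.symm (C a))) = C a := by
    rw [hΨa, cobordantAlgebra.subst, MvPolynomial.eval₂Hom_C]
  rw [← hc, conj_apply_map, sigmaR_algebraMap, A1.act_symm σ e τ hact, hC]


/-! ## The free model of a producer chart of the symmetric root -/

section Chart

variable {m : ℕ} (mo : Fin m → ℕ) (𝒜 : (Π j : Fin m, ZMod (mo j)) → AddSubgroup A) [GradedRing 𝒜]
  (hf : ∀ i, (e.symm ∘ ![X 0, X 1, X 2] : Fin 3 → A) i ∈ 𝒜 ((fun _ => (0 : Π j : Fin m, ZMod (mo j))) i))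
  (hx3 : e.symm (X 3) ∈ 𝒜 0) (hr0 : e.symm r ∈ 𝒜 0)
  {dbar : ℕ} (y : ↥(𝒜 0)) (hy : y ∈ (traceFiltration 𝒜 (e.symm ∘ ![X 0, X 1, X 2] : Fin 3 → A) ![δ + 1, 1, 1]).ideal dbar) (hσy : τ (y : A) = y)

include hΨs in
/-- Row: `τ′ (x_none) = x_none`. -/
theorem sym_model_row_none :
    conj (chartRingEquivAway 𝒜 _ _ dbar y hy Ψ) (sigmaChart 𝒜 _ _ dbar y hy τ hσJ hp hσp hσy)
        (algebraMap (MvPolynomial (Option (Fin 4)) k) (Localization.Away (Ψ (coverElement 𝒜 _ _ dbar y hy))) (X none)) =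
      algebraMap (MvPolynomial (Option (Fin 4)) k) (Localization.Away (Ψ (coverElement 𝒜 _ _ dbar y hy))) (X none) := by
  have h := modelSigma_apply_algebraMap mo 𝒜 _ _ dbar y hy τ hσJ hp hσp hσy Ψ (Ψ.symm (X none))
  rw [Ψ.apply_symm_apply] at h
  rw [h, ← conj_apply, sym_sigmaP_X_none δ e τ hp hσp hσJ Ψ hΨs]

include hact h0 hΨ0 in
/-- Row: `τ′ X₀′ = X₀′`. -/
theorem sym_model_row_zero :
    conj (chartRingEquivAway 𝒜 _ _ dbar y hy Ψ) (sigmaChart 𝒜 _ _ dbar y hy τ hσJ hp hσp hσy)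
        (algebraMap (MvPolynomial (Option (Fin 4)) k) (Localization.Away (Ψ (coverElement 𝒜 _ _ dbar y hy))) (X (some 0))) =
      algebraMap (MvPolynomial (Option (Fin 4)) k) (Localization.Away (Ψ (coverElement 𝒜 _ _ dbar y hy))) (X (some 0)) := by
  have h := modelSigma_apply_algebraMap mo 𝒜 _ _ dbar y hy τ hσJ hp hσp hσy Ψ (Ψ.symm (X (some 0)))
  rw [Ψ.apply_symm_apply] at h
  rw [h, ← conj_apply, sym_sigmaP_X_some_zero σ h0 δ e τ hact hp hσp hσJ Ψ hΨ0]

include hact h1 hΨ0 hΨ1 hΨs in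
/-- Row: `τ′ X₁′ = X₁′ + x_none^δ · X₀′`. -/
theorem sym_model_row_one :
    conj (chartRingEquivAway 𝒜 _ _ dbar y hy Ψ) (sigmaChart 𝒜 _ _ dbar y hy τ hσJ hp hσp hσy)
        (algebraMap (MvPolynomial (Option (Fin 4)) k) (Localization.Away (Ψ (coverElement 𝒜 _ _ dbar y hy))) (X (some 1))) =
      algebraMap (MvPolynomial (Option (Fin 4)) k) (Localization.Away (Ψ (coverElement 𝒜 _ _ dbar y hy))) (X (some 1)) +
        algebraMap (MvPolynomial (Option (Fin 4)) k) (Localization.Away (Ψ (coverElement 𝒜 _ _ dbar y hy))) (X none) ^ δ *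
          algebraMap (MvPolynomial (Option (Fin 4)) k) (Localization.Away (Ψ (coverElement 𝒜 _ _ dbar y hy))) (X (some 0)) := by
  have h := modelSigma_apply_algebraMap mo 𝒜 _ _ dbar y hy τ hσJ hp hσp hσy Ψ (Ψ.symm (X (some 1)))
  rw [Ψ.apply_symm_apply] at h
  rw [h, ← conj_apply, sym_sigmaP_X_some_one σ h1 δ e τ hact hp hσp hσJ Ψ hΨs hΨ0 hΨ1, map_add, map_mul, map_pow]

include hact h2 hΨ0 hΨ2 hΨs in
/-- Row: `τ′ X₂′ = X₂′ + x_none^δ · X₀′`. -/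
theorem sym_model_row_two :
    conj (chartRingEquivAway 𝒜 _ _ dbar y hy Ψ) (sigmaChart 𝒜 _ _ dbar y hy τ hσJ hp hσp hσy)
        (algebraMap (MvPolynomial (Option (Fin 4)) k) (Localization.Away (Ψ (coverElement 𝒜 _ _ dbar y hy))) (X (some 2))) =
      algebraMap (MvPolynomial (Option (Fin 4)) k) (Localization.Away (Ψ (coverElement 𝒜 _ _ dbar y hy))) (X (some 2)) +
        algebraMap (MvPolynomial (Option (Fin 4)) k) (Localization.Away (Ψ (coverElement 𝒜 _ _ dbar y hy))) (X none) ^ δ *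
          algebraMap (MvPolynomial (Option (Fin 4)) k) (Localization.Away (Ψ (coverElement 𝒜 _ _ dbar y hy))) (X (some 0)) := by
  have h := modelSigma_apply_algebraMap mo 𝒜 _ _ dbar y hy τ hσJ hp hσp hσy Ψ (Ψ.symm (X (some 2)))
  rw [Ψ.apply_symm_apply] at h
  rw [h, ← conj_apply, sym_sigmaP_X_some_two σ h2 δ e τ hact hp hσp hσJ Ψ hΨs hΨ0 hΨ2, map_add, map_mul, map_pow]

include hr hact h3 hδ hΨa hΨ1 hΨs in
/-- Row: `τ′ x₃ = x₃ + x_none^δ · X₁′ · R` for any `R` with `subst r = x_none^{δ−1} · R`. -/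
theorem sym_model_row_three (R : MvPolynomial (Option (Fin 4)) k) (hR : cobordantAlgebra.subst k (![δ + 1, 1, 1, 0] : Fin 4 → ℕ) r = X none ^ (δ - 1) * R) :
    conj (chartRingEquivAway 𝒜 _ _ dbar y hy Ψ) (sigmaChart 𝒜 _ _ dbar y hy τ hσJ hp hσp hσy)
        (algebraMap (MvPolynomial (Option (Fin 4)) k) (Localization.Away (Ψ (coverElement 𝒜 _ _ dbar y hy))) (X (some 3))) =
      algebraMap (MvPolynomial (Option (Fin 4)) k) (Localization.Away (Ψ (coverElement 𝒜 _ _ dbar y hy))) (X (some 3)) +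
        algebraMap (MvPolynomial (Option (Fin 4)) k) (Localization.Away (Ψ (coverElement 𝒜 _ _ dbar y hy))) (X none) ^ δ *
          (algebraMap (MvPolynomial (Option (Fin 4)) k) (Localization.Away (Ψ (coverElement 𝒜 _ _ dbar y hy))) (X (some 1)) *
            algebraMap (MvPolynomial (Option (Fin 4)) k) (Localization.Away (Ψ (coverElement 𝒜 _ _ dbar y hy))) R) := by
  have hRR : Ψ ⟨_, C_mul_T_mem_cobordantAlgebra _ _ hr⟩ = R := by
    have h := sym_model_tail_pin δ r e hr Ψ hΨa hΨs
    rw [hR] at h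
    exact mul_left_cancel₀ (pow_ne_zero _ (MvPolynomial.X_ne_zero none)) h
  have h := modelSigma_apply_algebraMap mo 𝒜 _ _ dbar y hy τ hσJ hp hσp hσy Ψ (Ψ.symm (X (some 3)))
  rw [Ψ.apply_symm_apply] at h
  rw [h, ← conj_apply, sym_sigmaP_X_some_three σ δ r h3 e τ hact hr hδ hp hσp hσJ Ψ hΨa hΨs hΨ1, hRR, map_add, map_mul, map_mul, map_pow]

include hact hC hΨa in
/-- `τ′` fixes `H⁻¹` and the constants. -/
theorem sym_model_fixed : ∀ g' ∈ (({IsLocalization.Away.invSelf (Ψ (coverElement 𝒜 _ _ dbar y hy))} : Set (Localization.Away (Ψ (coverElement 𝒜 _ _ dbar y hy)))) ∪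
      Set.range (algebraMap k (Localization.Away (Ψ (coverElement 𝒜 _ _ dbar y hy))))),
    conj (chartRingEquivAway 𝒜 _ _ dbar y hy Ψ) (sigmaChart 𝒜 _ _ dbar y hy τ hσJ hp hσp hσy) g' = g' := by
  rintro g' (hg | ⟨a, rfl⟩)
  · rw [Set.mem_singleton_iff.mp hg]
    exact modelSigma_invSelf mo 𝒜 _ _ dbar y hy τ hσJ hp hσp hσy Ψ
  · rw [IsScalarTower.algebraMap_apply k (MvPolynomial (Option (Fin 4)) k) (Localization.Away _) a, MvPolynomial.algebraMap_eq]
    have h := modelSigma_apply_algebraMap mo 𝒜 _ _ dbar y hy τ hσJ hp hσp hσy Ψ (Ψ.symm (C a))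
    rw [Ψ.apply_symm_apply] at h
    rw [h, ← conj_apply, sym_sigmaP_C σ hC δ e τ hact hp hσp hσJ Ψ hΨa]

/-! ### Degrees relative to `θ = consIndexEquiv mo (1, 0)` -/
include hf hΨ0 in
/-- `X₀′` has degree `(δ+1) • θ`. -/
theorem sym_model_degree_zero :
    letI := chartNodeGradedRing mo 𝒜 (e.symm ∘ ![X 0, X 1, X 2] : Fin 3 → A) ![δ + 1, 1, 1] hf dbar y hy
    algebraMap (MvPolynomial (Option (Fin 4)) k) (Localization.Away (Ψ (coverElement 𝒜 _ _ dbar y hy))) (X (some 0)) ∈ mapGrading (chartNodeGrading mo 𝒜 (e.symm ∘ ![X 0, X 1, X 2] : Fin 3 → A) ![δ + 1, 1, 1] hf dbar y hy) (chartRingEquivAway 𝒜 _ _ dbar y hy Ψ) ((δ + 1) • consIndexEquiv mo ((1 : ℤ), (0 : Π j : Fin m, ZMod (mo j)))) := by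
  letI := chartNodeGradedRing mo 𝒜 (e.symm ∘ ![X 0, X 1, X 2] : Fin 3 → A) ![δ + 1, 1, 1] hf dbar y hy
  have h := algebraMap_mem_mapGrading_chartNode mo 𝒜 (e.symm ∘ ![X 0, X 1, X 2] : Fin 3 → A) ![δ + 1, 1, 1] hf dbar y hy Ψ
    (u'_mem_reesPiece 𝒜 (e.symm ∘ ![X 0, X 1, X 2] : Fin 3 → A) (δ := fun _ => 0) ![δ + 1, 1, 1] hf 0)
  rw [hΨ0] at h
  have hidx : consIndexEquiv mo ((((![δ + 1, 1, 1] : Fin 3 → ℕ) 0 : ℕ) : ℤ), (fun _ : Fin 3 => (0 : Π j : Fin m, ZMod (mo j))) 0) =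
      (δ + 1) • consIndexEquiv mo ((1 : ℤ), (0 : Π j : Fin m, ZMod (mo j))) := by
    change consIndexEquiv mo (((δ + 1 : ℕ) : ℤ), (0 : Π j : Fin m, ZMod (mo j))) = _
    exact consIndexEquiv_nat_zero mo (δ + 1)
  rw [hidx] at h
  exact h

include hf hΨ1 in
/-- `X₁′` has degree `θ`. -/
theorem sym_model_degree_one :
    letI := chartNodeGradedRing mo 𝒜 (e.symm ∘ ![X 0, X 1, X 2] : Fin 3 → A) ![δ + 1, 1, 1] hf dbar y hy
    algebraMap (MvPolynomial (Option (Fin 4)) k) (Localization.Away (Ψ (coverElement 𝒜 _ _ dbar y hy))) (X (some 1)) ∈ mapGrading (chartNodeGrading mo 𝒜 (e.symm ∘ ![X 0, X 1, X 2] : Fin 3 → A) ![δ + 1, 1, 1] hf dbar y hy) (chartRingEquivAway 𝒜 _ _ dbar y hy Ψ) (consIndexEquiv mo ((1 : ℤ), (0 : Π j : Fin m, ZMod (mo j)))) := by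
  letI := chartNodeGradedRing mo 𝒜 (e.symm ∘ ![X 0, X 1, X 2] : Fin 3 → A) ![δ + 1, 1, 1] hf dbar y hy
  have h := algebraMap_mem_mapGrading_chartNode mo 𝒜 (e.symm ∘ ![X 0, X 1, X 2] : Fin 3 → A) ![δ + 1, 1, 1] hf dbar y hy Ψ
    (u'_mem_reesPiece 𝒜 (e.symm ∘ ![X 0, X 1, X 2] : Fin 3 → A) (δ := fun _ => 0) ![δ + 1, 1, 1] hf 1)
  rw [hΨ1] at h
  have hidx : consIndexEquiv mo ((((![δ + 1, 1, 1] : Fin 3 → ℕ) 1 : ℕ) : ℤ), (fun _ : Fin 3 => (0 : Π j : Fin m, ZMod (mo j))) 1) =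
      consIndexEquiv mo ((1 : ℤ), (0 : Π j : Fin m, ZMod (mo j))) := by
    change consIndexEquiv mo (((1 : ℕ) : ℤ), (0 : Π j : Fin m, ZMod (mo j))) = _
    rw [Nat.cast_one]
  rw [hidx] at h
  exact h

include hf hΨ2 in
/-- `X₂′` has degree `θ`. -/
theorem sym_model_degree_two :
    letI := chartNodeGradedRing mo 𝒜 (e.symm ∘ ![X 0, X 1, X 2] : Fin 3 → A) ![δ + 1, 1, 1] hf dbar y hy
    algebraMap (MvPolynomial (Option (Fin 4)) k) (Localization.Away (Ψ (coverElement 𝒜 _ _ dbar y hy))) (X (some 2)) ∈ mapGrading (chartNodeGrading mo 𝒜 (e.symm ∘ ![X 0, X 1, X 2] : Fin 3 → A) ![δ + 1, 1, 1] hf dbar y hy) (chartRingEquivAway 𝒜 _ _ dbar y hy Ψ) (consIndexEquiv mo ((1 : ℤ), (0 : Π j : Fin m, ZMod (mo j)))) := by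
  letI := chartNodeGradedRing mo 𝒜 (e.symm ∘ ![X 0, X 1, X 2] : Fin 3 → A) ![δ + 1, 1, 1] hf dbar y hy
  have h := algebraMap_mem_mapGrading_chartNode mo 𝒜 (e.symm ∘ ![X 0, X 1, X 2] : Fin 3 → A) ![δ + 1, 1, 1] hf dbar y hy Ψ
    (u'_mem_reesPiece 𝒜 (e.symm ∘ ![X 0, X 1, X 2] : Fin 3 → A) (δ := fun _ => 0) ![δ + 1, 1, 1] hf 2)
  rw [hΨ2] at h
  have hidx : consIndexEquiv mo ((((![δ + 1, 1, 1] : Fin 3 → ℕ) 2 : ℕ) : ℤ), (fun _ : Fin 3 => (0 : Π j : Fin m, ZMod (mo j))) 2) =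
      consIndexEquiv mo ((1 : ℤ), (0 : Π j : Fin m, ZMod (mo j))) := by
    change consIndexEquiv mo (((1 : ℕ) : ℤ), (0 : Π j : Fin m, ZMod (mo j))) = _
    rw [Nat.cast_one]
  rw [hidx] at h
  exact h

include hx3 hΨa in
/-- `x₃` has degree `0`. -/
theorem sym_model_degree_three :
    letI := chartNodeGradedRing mo 𝒜 (e.symm ∘ ![X 0, X 1, X 2] : Fin 3 → A) ![δ + 1, 1, 1] hf dbar y hy
    algebraMap (MvPolynomial (Option (Fin 4)) k) (Localization.Away (Ψ (coverElement 𝒜 _ _ dbar y hy))) (X (some 3)) ∈ mapGrading (chartNodeGrading mo 𝒜 (e.symm ∘ ![X 0, X 1, X 2] : Fin 3 → A) ![δ + 1, 1, 1] hf dbar y hy) (chartRingEquivAway 𝒜 _ _ dbar y hy Ψ) 0 := by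
  letI := chartNodeGradedRing mo 𝒜 (e.symm ∘ ![X 0, X 1, X 2] : Fin 3 → A) ![δ + 1, 1, 1] hf dbar y hy
  have h := algebraMap_mem_mapGrading_chartNode mo 𝒜 (e.symm ∘ ![X 0, X 1, X 2] : Fin 3 → A) ![δ + 1, 1, 1] hf dbar y hy Ψ
    (algebraMap_mem_reesPiece 𝒜 (e.symm ∘ ![X 0, X 1, X 2] : Fin 3 → A) ![δ + 1, 1, 1] hx3)
  rw [sym_model_X_three δ e Ψ hΨa, Prod.mk_zero_zero, map_zero] at h
  exact h

include hr0 in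
/-- `R = Ψ(e⁻¹r·t^{δ−1})` has degree `(δ−1) • θ`. -/
theorem sym_model_degree_tail :
    letI := chartNodeGradedRing mo 𝒜 (e.symm ∘ ![X 0, X 1, X 2] : Fin 3 → A) ![δ + 1, 1, 1] hf dbar y hy
    algebraMap (MvPolynomial (Option (Fin 4)) k) (Localization.Away (Ψ (coverElement 𝒜 _ _ dbar y hy))) (Ψ ⟨_, C_mul_T_mem_cobordantAlgebra _ _ hr⟩) ∈ mapGrading (chartNodeGrading mo 𝒜 (e.symm ∘ ![X 0, X 1, X 2] : Fin 3 → A) ![δ + 1, 1, 1] hf dbar y hy) (chartRingEquivAway 𝒜 _ _ dbar y hy Ψ) ((δ - 1) • consIndexEquiv mo ((1 : ℤ), (0 : Π j : Fin m, ZMod (mo j)))) := by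
  letI := chartNodeGradedRing mo 𝒜 (e.symm ∘ ![X 0, X 1, X 2] : Fin 3 → A) ![δ + 1, 1, 1] hf dbar y hy
  have h := algebraMap_mem_mapGrading_chartNode mo 𝒜 (e.symm ∘ ![X 0, X 1, X 2] : Fin 3 → A) ![δ + 1, 1, 1] hf dbar y hy Ψ
    (mk_mem_reesPiece 𝒜 (e.symm ∘ ![X 0, X 1, X 2] : Fin 3 → A) ![δ + 1, 1, 1] hr0 (C_mul_T_mem_cobordantAlgebra _ _ hr))
  rw [consIndexEquiv_nat_zero mo (δ - 1)] at h
  exact h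

include hf hΨs in
/-- `x_none = s` has degree `−θ`. -/
theorem sym_model_degree_none :
    letI := chartNodeGradedRing mo 𝒜 (e.symm ∘ ![X 0, X 1, X 2] : Fin 3 → A) ![δ + 1, 1, 1] hf dbar y hy
    algebraMap (MvPolynomial (Option (Fin 4)) k) (Localization.Away (Ψ (coverElement 𝒜 _ _ dbar y hy))) (X none) ∈ mapGrading (chartNodeGrading mo 𝒜 (e.symm ∘ ![X 0, X 1, X 2] : Fin 3 → A) ![δ + 1, 1, 1] hf dbar y hy) (chartRingEquivAway 𝒜 _ _ dbar y hy Ψ) (-(consIndexEquiv mo ((1 : ℤ), (0 : Π j : Fin m, ZMod (mo j))))) := by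
  letI := chartNodeGradedRing mo 𝒜 (e.symm ∘ ![X 0, X 1, X 2] : Fin 3 → A) ![δ + 1, 1, 1] hf dbar y hy
  have h := algebraMap_mem_mapGrading_chartNode mo 𝒜 (e.symm ∘ ![X 0, X 1, X 2] : Fin 3 → A) ![δ + 1, 1, 1] hf dbar y hy Ψ
    (s_mem_reesPiece 𝒜 (e.symm ∘ ![X 0, X 1, X 2] : Fin 3 → A) ![δ + 1, 1, 1])
  rw [hΨs] at h
  have hidx : consIndexEquiv mo ((-1 : ℤ), (0 : Π j : Fin m, ZMod (mo j))) = -(consIndexEquiv mo ((1 : ℤ), (0 : Π j : Fin m, ZMod (mo j)))) := by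
    rw [consIndexEquiv_int_zero mo (-1), neg_one_zsmul]
  rw [hidx] at h
  exact h

include hf in
/-- `H⁻¹` has degree `−(dbar • θ)`. -/
theorem sym_model_degree_invSelf :
    letI := chartNodeGradedRing mo 𝒜 (e.symm ∘ ![X 0, X 1, X 2] : Fin 3 → A) ![δ + 1, 1, 1] hf dbar y hy
    IsLocalization.Away.invSelf (Ψ (coverElement 𝒜 _ _ dbar y hy)) ∈ mapGrading (chartNodeGrading mo 𝒜 (e.symm ∘ ![X 0, X 1, X 2] : Fin 3 → A) ![δ + 1, 1, 1] hf dbar y hy) (chartRingEquivAway 𝒜 _ _ dbar y hy Ψ) (-(dbar • (consIndexEquiv mo ((1 : ℤ), (0 : Π j : Fin m, ZMod (mo j)))))) := by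
  letI := chartNodeGradedRing mo 𝒜 (e.symm ∘ ![X 0, X 1, X 2] : Fin 3 → A) ![δ + 1, 1, 1] hf dbar y hy
  have h := invSelf_mem_mapGrading_chartNode mo 𝒜 (e.symm ∘ ![X 0, X 1, X 2] : Fin 3 → A) ![δ + 1, 1, 1] hf dbar y hy Ψ
  have hidx : consIndexEquiv mo (-(dbar : ℤ), (0 : Π j : Fin m, ZMod (mo j))) = -(dbar • (consIndexEquiv mo ((1 : ℤ), (0 : Π j : Fin m, ZMod (mo j))))) := by
    rw [consIndexEquiv_int_zero mo, neg_zsmul, natCast_zsmul]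
  rw [hidx] at h
  exact h

/-! ### Residual-section pins -/
include hΨ0 in
/-- Pin: `Φ(u₀′ⁿ · c⁻¹) = X₀′ⁿ · H⁻¹`. -/
theorem sym_model_residual_zero (n : ℕ) :
    chartRingEquivAway 𝒜 _ _ dbar y hy Ψ (algebraMap _ (ChartRing 𝒜 (e.symm ∘ ![X 0, X 1, X 2] : Fin 3 → A) ![δ + 1, 1, 1] dbar y hy)
        (cobordantAlgebra.u' (e.symm ∘ ![X 0, X 1, X 2] : Fin 3 → A) ![δ + 1, 1, 1] 0 ^ n) * IsLocalization.Away.invSelf (coverElement 𝒜 _ _ dbar y hy)) =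
      algebraMap (MvPolynomial (Option (Fin 4)) k) (Localization.Away (Ψ (coverElement 𝒜 _ _ dbar y hy))) (X (some 0)) ^ n * IsLocalization.Away.invSelf (Ψ (coverElement 𝒜 _ _ dbar y hy)) := by
  rw [chartRingEquivAway_algebraMap_mul_invSelf, map_pow, hΨ0, map_pow]

include hΨ1 in
/-- Pin: `Φ((u₁′ · r t^{δ−1})ⁿ · c⁻¹) = (X₁′ · R)ⁿ · H⁻¹`. -/
theorem sym_model_residual_one (n : ℕ) :
    chartRingEquivAway 𝒜 _ _ dbar y hy Ψ (algebraMap _ (ChartRing 𝒜 (e.symm ∘ ![X 0, X 1, X 2] : Fin 3 → A) ![δ + 1, 1, 1] dbar y hy)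
        ((cobordantAlgebra.u' (e.symm ∘ ![X 0, X 1, X 2] : Fin 3 → A) ![δ + 1, 1, 1] 1 * ⟨_, C_mul_T_mem_cobordantAlgebra _ _ hr⟩) ^ n) *
          IsLocalization.Away.invSelf (coverElement 𝒜 _ _ dbar y hy)) =
      (algebraMap (MvPolynomial (Option (Fin 4)) k) (Localization.Away (Ψ (coverElement 𝒜 _ _ dbar y hy))) (X (some 1)) *
          algebraMap (MvPolynomial (Option (Fin 4)) k) (Localization.Away (Ψ (coverElement 𝒜 _ _ dbar y hy))) (Ψ ⟨_, C_mul_T_mem_cobordantAlgebra _ _ hr⟩)) ^ n *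
        IsLocalization.Away.invSelf (Ψ (coverElement 𝒜 _ _ dbar y hy)) := by
  rw [chartRingEquivAway_algebraMap_mul_invSelf, map_pow, map_mul, hΨ1, map_pow, map_mul]

end Chart

end Summit.ResolutionOfSingularities.ResolutionOfSingularities.Theorems.WildQuotientResolution.S1.KillCert.Sym

end
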